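import Summits.QuantumAdvantage.QuantumAdvantage.Theses.CubicForrelation
import Literature.Computability.QuantumComplexity.SignedCubicForrelation
import Literature.Computability.QuantumComplexity.SignedForrelationMem
import Literature.Computability.Cryptography.ClassBQPProofs
import Literature.Computability.QuantumComplexity.SimUniformity
import Summits.QuantumAdvantage.QuantumAdvantage.Theorems.CubicForrelationSignedExactSliceIsLiftDefs

/-!
# Disproof of `SignedExactSliceIsLift` (K2, stmt-QuantumAdvantage-14830) — findings

Crux K2 := `NearExactIsExact → slice ∈ promiseLift BQP`, slice = the signed EXACT cubic slice
(`signedExactCubicForrelationProblem 2`: codes of `B₂`-instances, `k = 2`, `n` even, degree `≤ 3`;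
yes `Φ = 1`, no `Φ = −1`). Disprover: refuter-cdisprove-stmt-QuantumAdvantage-14830-0, cycle 1
(2026-08-16). Every claim below is a checked theorem unless marked PAPER or `sorry`.

## Findings (index)

* §0 ANATOMY (checked). `crux_iff` (K2 by name, `Iff.rfl`); `crux_of_not_isolation` (¬r2 ⇒ K2:
  K2 is VACUOUSLY true if the rank-2 crux `NearExactIsExact` dies); `crux_of_conclusion`;
  `not_crux_iff` (¬K2 ↔ r2 ∧ slice ∉ promiseLift BQP); `not_promiseP_of_not_crux`,
  `not_promiseBPP_of_not_crux` (a refutation of K2 would be a LOWER BOUND: no `P`/`BPP` language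
  separates the Φ = 1 codes from the Φ = −1 codes — at least as strong as the failure of the r3-KILL
  stmt-14671 in its deterministic form); `crux_of_promiseP` (conversely the deterministic r3-kill
  `slice ∈ PromiseP` PROVES K2 outright); `slice_mem_PromiseBQP` (landed, sub-promise) and
  `conclusion_of_globalLift` (K2's conclusion is the LOCAL instance of the global schema
  `PromiseBQP ⊆ promiseLift BQP`, which is relativized-FALSE:
  `Literature.Barriers.QuantumAdvantage.PromiseLiftRelativization`; so any proof of K2 is white-box —
  the picked line's Möbius interpolation is exactly that).
  VERDICT: no unconditional kill is possible from this seat: ¬K2 needs r2 (open) AND a lower bound.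
  No formalisation defect found: `promiseLift` (Promise.lean:152) is the honest everywhere-gapped lift,
  `BQP = BQPWith cliffordT (1/3)` quantifies over all uniform oracle-free families, the slice is
  disjoint (`encode_injective`) and inhabited on both sides (n = 2: `andPairInstance`, its `negAt 1`;
  n = 0: constant pairs), the acceptance formula of the landed family is EXACT
  (`PhaseQuery.acceptProbOn_family`), `ρ = 1` for even `n` with `n ≤ #R + 1` (§2 `norm_phiFin_of_le`),
  `n ≤ #R + 1` is automatic on `|Φ| ≥ 3/5` (`SgnForrMem.n_le_of_promise`), `n = 0` is harmless
  (`M = (1 ± 1)/2`), the empty-register junk value `acceptProb = 0` never meets a slice code.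
* §1 LOAD-BEARING `NearExactIsExact` (checked logic; status OPEN both ways). `CruxWithoutIsolation`
  := the bare conclusion. `crux_of_without`; `crux_iff_not_isolation_of_not_without` (if the r2-free
  version fails then K2 ↔ ¬r2); `lower_bound_of_not_without` (its failure is again a lower bound
  `slice ∉ PromiseP ∧ slice ∉ PromiseBPP`). So "any proof must use r2" CANNOT be certified by a
  `_false_without_` theorem here; what CAN be certified is mechanism-level: §2.
* §2 MECHANISM-LEVEL NEGATIVES (checked; = Theorems/SignedExactSliceIsLift/Negative/
  LandedFamilyUngapped.lean, p100692 ACCEPTED/LANDED). The LANDED signed family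
  `PhaseQuery.family SgnForrMem.paramsS` accepts the well-formed cubic code `(2, 2, x₀∧x₁, x₀∧¬x₁)`
  (Φ = 0, every wire read) with probability EXACTLY `37/64 ∈ (1/3, 2/3)`
  (`exists_wf_cubic_code_ungapped`): it decides NO language in the BQP sense
  (`landedFamily_not_bqp_decider`), and the `K = 1` shortcut of the line's stub V — "the landed family
  already rejects every WF cubic code with Φ ≠ 1 with probability ≤ 1/3" — is FALSE independently of r2
  (`not_noSide_le_third`). Reading: isolation bounds acceptances away from `1` ONLY; amplification at
  the TOP of `[0,1]` (stub A) is load-bearing; the separating language can never be F₀'s own.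
  Helpers `norm_phiFin_of_le` / `acceptProbOn_of_le`: EXACT modulus `(1+Φ)/2` and acceptance
  `1 − (1 − ((1+Φ)/2)²)³` off the promise (k = 2, n even, n ≤ #R + 1) — the landed
  `norm_phiFin_of_promise` hides `ρ` and assumes `|Φ| ≥ 3/5`.
* §2b DEGREE PROJECTION IS LOAD-BEARING (checked; = Theorems/SignedExactSliceIsLift/Negative/
  DegreeBlindUngapped.lean, p103712 ACCEPTED/LANDED; statements quoted in the §2b comment block below, proofs
  there): for every t ≥ 1 an all-wires-read B₂ instance (k = 2, n = 2t, g = inner-product bent,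
  f = g ⊕ [x = 0], full degree) has Φ = 1 − 2/4^t — off the exact slice on both sides — and the landed
  family accepts its code with probability ≥ 1 − 2/4^t (`exists_allRead_code_value`); hence for EVERY K
  some such code has acc^K > 1/3 (`degreeBlind_andPower_ungapped`): no constant AND-power of F₀ behind a
  degree-BLIND canonicaliser decides a separating language. This is the triage trap "a family reading
  C.eval is not gapped off the promise" as a theorem; stub C's degree-3 projection is where r2 enters.
* §2c TIGHTNESS TRANSFER FOR THE TOP GAP (checked, rc 0 / 0 sorry; neg/TopGapTightness.lean in the seat
  folder, proposed as Negative/TopGapTightness.lean): EVERY cubic pair (f, g) on m + m bits with g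
  depending on every coordinate (e.g. bent: `depends_of_W_ne_zero`) is realised by a WF cubic code with
  acceptance EXACTLY 1 − (1 − ((1+Φ)/2)²)³ (`exists_wf_code_of_pair`), so every admissible p₀ of stub V
  (for the landed family) is ≥ that quantity for every NON-exact such pair (`stubV_p0_ge_of_pair`,
  `_W`): each near-exact cubic pair found on the r2 side is at once a lower bound on K2's raw top gap.
  Self-contained instantiation at n = 4 (Kasami–Tokura pair, Φ = 3/4, `forrelation_kasamiTokura`):
  p₀ ≥ 1 − (15/64)³ ≈ 0.9871, K ≥ 52 copies (`andPower_copies_ge_52`); with the Φ = 15/16 pair of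
  Theorems/NearExactIsExact/Negative/FifteenSixteenths.lean (module unbuilt on the farm at writing — a
  two-line follow-up): p₀ ≥ 1 − (63/1024)³ ≈ 0.99977, K ≥ 2863.
* §3 LINE `Sketch` = idea reduce-then-lift (PICKED.md; stubs C TotalCanonicaliser, V
  LandedFamilyValueSet, A AndPowerAmplification, C1/C2 Möbius). STUB V IS PROVED HERE (positive
  service to the lead, copy at will): `stubV_yes` (acceptance EXACTLY 1 on slice.yes, no r2),
  `stubV_no` (r2 ⇒ ∃ p₀ < 1 bounding the acceptance on `gappedSlice.no`), `stubV_holds :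
  LandedFamilyValueSet` (statement copied verbatim from the skeleton, definitions `WF`/`gappedSlice`
  inlined identically). STUB A: true on paper (fan-out of the classical input by CNOTs, K disjoint
  copies, Toffoli-ladder AND into a clean ancilla — Toffoli is exact over Clifford+T —, SWAP onto wire
  0; Born weights of disjoint blocks on a product input multiply, so `acc' = acc^K` EXACTLY; the
  empty-register junk `acc = 0` forces `acc' = 0`, satisfiable with one idle ancilla; uniformity is
  composition of poly-time descriptions; kit: PostBQPAmp.family, CWrap, kernelProb_family_eq);
  `andPower_at_one` records that the statement typechecks against the tree objects (K = 1). By §2 any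
  K with `(37/64)^K ≤ 1/3` needs `K ≥ 3`, and the real requirement is `p₀(θ)^K ≤ 1/3`, `K ≈ 4.7·10³`
  at θ = 15/16. STUB C: plumbing (FP emission) + two textbook facts C1/C2 (Möbius inversion on the
  weight-≤3 down-set); remark for the lead: the WF clause `n ≤ #R + 1` forces the emitter to touch
  ≥ n − 1 wires syntactically; dropping it from WF would keep V true (idle wires among the `W_d`
  layout wires only shrink `Φ_W` by a factor ≤ 1/√2, PAPER: `forrelation_cfun` + `WdS = min(n,#R+1)+…`)
  at the price of the general-`W_d` amplitude analysis — a trade-off, not a defect. JOINT SUFFICIENCY: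
  `signedExactSliceIsLift_of_stubs` is kernel-checked in the skeleton (no gap smuggled).
* §3b TARGETS = the lead's registered stubs (Lines/Sketch.lean, 13:31Z; vocabulary
  Theorems/CubicForrelationSignedExactSliceIsLiftDefs.lean). stub_V: PROVED verbatim over the Defs vocabulary
  (evidence StubVProof.lean, `stub_V_proof`, rc 0 / 0 sorry). stub_moebius conj. 2, stub_anfCircuit's netlist
  semantics, the guard and the n = 0 fallback: CHECKED on small models by `decide` — recorded below as theorems
  (`moebius_check_*`, `anfPC_check_*`, `guard_check`, `fallback_value_bits`); canonMirror end-to-end on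
  `encode andPairInstance` / `negAt 1` checked by `native_decide` in the seat's Scratch.lean (not recorded here:
  non-standard axiom). REMARK (harmless): the fallback `(0,2,[anfPC 0 [], anfPC 0 []])` computes (false,false)
  on zero bits ⇒ Φ = +1 ⇒ it is a YES code — junk strings land IN the separating language; a rejecting fallback
  would be `(0,2,[anfPC 0 [[]], anfPC 0 []])`. No stub broken; joint sufficiency kernel-checked in the skeleton.
* §4 NEAR-MISSES (`sorry`, NOT expected to close): `not_cruxWithoutIsolation`, `crux_refuted` — both
  are lower bounds (§0/§1); recorded only to mark the obstruction.

Attacks run this cycle (all resisted): degenerate n = 0 / empty register / odd n / idle wires;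
junk-model audit of `promiseLift`, `BQP`, `acceptProb`; vacuity (hinges on r2, attacked by the
r2 disprover: θ* ≥ 15/16, MM ceiling 31/32); strengthenings (EQP / C.eval-language / K = 1 family —
only the last is refutable, §2); hypothesis drop (r2: OPEN both ways, §1); barrier reduction
(global lift relativized-false ⇒ proof must be white-box; it is).
-/

noncomputable section

set_option linter.dupNamespace false -- D-0017: single-problem summit ⇒ `QuantumAdvantage.QuantumAdvantage` by design

namespace Summit.QuantumAdvantage.QuantumAdvantage.Cruxes.SignedExactSliceIsLift.Disproof

open Literature.Computability.Complexity Literature.Computability.Cryptography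
open Literature.Computability.QuantumComplexity
open Literature.Computability.QuantumComplexity.PhaseQuery
open Literature.Computability.QuantumComplexity.ForrMem
open Literature.Computability.QuantumComplexity.SgnForrMem
open Summit.QuantumAdvantage.QuantumAdvantage.Theses.CubicForrelation
  (NearExactIsExact SignedExactSliceIsLift SignedExactCubicForrelationNotPrBPP SignedExactCubicForrelationInPrBPP)

/-! ## §0 The crux by name; propositional anatomy -/

/-- K2's object: the signed exact cubic slice (route decl r3's promise problem, by `rfl`). -/
abbrev slice : PromiseProblem := signedExactCubicForrelationProblem 2

/-- K2 by name. -/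
theorem crux_iff : SignedExactSliceIsLift ↔ (NearExactIsExact → slice ∈ promiseLift BQP) := Iff.rfl

/-- VACUITY: if the isolation crux r2 is refuted, K2 holds trivially. -/
theorem crux_of_not_isolation (h : ¬ NearExactIsExact) : SignedExactSliceIsLift := fun h' => absurd h' h

/-- If the bare conclusion holds, K2 holds (r2 unused). -/
theorem crux_of_conclusion (h : slice ∈ promiseLift BQP) : SignedExactSliceIsLift := fun _ => h

/-- ¬K2 unfolds to: isolation holds AND no honest BQP language separates the slice. -/
theorem not_crux_iff : ¬ SignedExactSliceIsLift ↔ (NearExactIsExact ∧ slice ∉ promiseLift BQP) := by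
  rw [crux_iff, Classical.not_imp]

/-- A refutation of K2 proves the rank-2 crux r2. -/
theorem isolation_of_not_crux (h : ¬ SignedExactSliceIsLift) : NearExactIsExact := (not_crux_iff.1 h).1

/-- A refutation of K2 is a LOWER BOUND, I: no `P` language separates Φ = 1 from Φ = −1 codes
(`P ⊆ BQP`, landed `P_subset_BQP_holds`). This is the failure of the r3-KILL (stmt-14671) in its
deterministic form. -/
theorem not_promiseP_of_not_crux (h : ¬ SignedExactSliceIsLift) : slice ∉ PromiseP :=
  fun hP => (not_crux_iff.1 h).2 (promiseLift_mono P_subset_BQP_holds hP)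

/-- A refutation of K2 is a LOWER BOUND, II: no `BPP` language separates the slice
(`BPP ⊆ BQP`, landed `BPP_subset_BQP_holds`). -/
theorem not_promiseBPP_of_not_crux (h : ¬ SignedExactSliceIsLift) : slice ∉ PromiseBPP :=
  fun hP => (not_crux_iff.1 h).2 (promiseLift_mono BPP_subset_BQP_holds hP)

/-- Conversely the deterministic r3-kill PROVES K2 outright: a total poly-time sign algorithm for exact
cubic pairs is an honest separating language. -/
theorem crux_of_promiseP (h : slice ∈ PromiseP) : SignedExactSliceIsLift :=
  crux_of_conclusion (promiseLift_mono P_subset_BQP_holds h)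

/-- Same with an everywhere-gapped BPP separator. -/
theorem crux_of_promiseBPP (h : slice ∈ PromiseBPP) : SignedExactSliceIsLift :=
  crux_of_conclusion (promiseLift_mono BPP_subset_BQP_holds h)

/-- The slice is in `PromiseBQP` (landed: sub-promise of the signed cubic problem, AA18 Prop. 6). -/
theorem slice_mem_PromiseBQP : slice ∈ PromiseBQP :=
  mem_PromiseBQP_of_subset (signedExactCubicForrelationProblem_yes_subset 2)
    (signedExactCubicForrelationProblem_no_subset 2) signedCubicForrelationProblem_two_mem_PromiseBQP

/-- K2's conclusion is the LOCAL instance of the GLOBAL schema `PromiseBQP ⊆ promiseLift BQP` (which is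
relativized-false, `Literature.Barriers.QuantumAdvantage.PromiseLiftRelativization`): the global schema
would give it for free. Hence a proof of K2 must use white-box structure of THIS slice. -/
theorem conclusion_of_globalLift (h : PromiseBQP ⊆ promiseLift BQP) : slice ∈ promiseLift BQP :=
  h slice_mem_PromiseBQP

/-- … and so would K2. -/
theorem crux_of_globalLift (h : PromiseBQP ⊆ promiseLift BQP) : SignedExactSliceIsLift :=
  crux_of_conclusion (conclusion_of_globalLift h)

/-- Consistency with the route: K2's conclusion and the r3 hypothesis together already give a
`BQP` language outside `BPP`-as-honest-separator… precisely: conclusion ∧ (slice ∉ PromiseBPP) ⇒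
some `L ∈ BQP`, `L ∉ BPP` (the deciding theorem's five lines, minus `PromiseBPP ⊆ PromiseBPP'`). -/
theorem exists_bqp_not_bpp_of (h : slice ∈ promiseLift BQP) (h' : slice ∉ PromiseBPP) :
    ∃ L ∈ BQP, L ∉ BPP := by
  obtain ⟨L, hL, hy, hn⟩ := h
  exact ⟨L, hL, fun hB => h' ⟨L, hB, hy, hn⟩⟩

/-! ## §1 Load-bearing hypothesis `NearExactIsExact`: OPEN both ways (checked logic) -/

/-- K2 with the isolation hypothesis DROPPED: the bare conclusion. -/
def CruxWithoutIsolation : Prop := slice ∈ promiseLift BQP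

/-- Dropping the hypothesis strengthens: `CruxWithoutIsolation → K2`. -/
theorem crux_of_without (h : CruxWithoutIsolation) : SignedExactSliceIsLift := crux_of_conclusion h

/-- If the r2-free version FAILS then K2 is exactly `¬ r2` (so K2 and r2 could not both be theorems). -/
theorem crux_iff_not_isolation_of_not_without (h : ¬ CruxWithoutIsolation) :
    SignedExactSliceIsLift ↔ ¬ NearExactIsExact :=
  ⟨fun hK hr => h (hK hr), crux_of_not_isolation⟩

/-- … and that failure would itself be a lower bound (no `P`, no honest `BPP` separator). This is why
no `_false_without_` theorem can certify that r2 is load-bearing: both `CruxWithoutIsolation` (⇐ the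
deterministic r3-kill) and its negation (a circuit lower bound) are out of reach. -/
theorem lower_bound_of_not_without (h : ¬ CruxWithoutIsolation) : slice ∉ PromiseP ∧ slice ∉ PromiseBPP :=
  ⟨fun hP => h (promiseLift_mono P_subset_BQP_holds hP), fun hP => h (promiseLift_mono BPP_subset_BQP_holds hP)⟩

/-! ## §2 Mechanism-level negatives (checked): the landed signed family is UNGAPPED

(= `Theorems/SignedExactSliceIsLift/Negative/LandedFamilyUngapped.lean`, proposal p100692; duplicated
here so that this work file is self-contained until that file lands.) -/

/-- **Exact modulus off the promise**: `k = 2`, `n` even, `n ≤ #R + 1` ⇒ `‖φ_fin‖ = (1 + Φ)/2`.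
[cite: AaronsonAmbainis2018, §3.2 Prop. 6] -/
theorem norm_phiFin_of_le (I : KForrelationInstance) (hk : I.k = 2) (he : Even I.n)
    (h : I.n ≤ sR I + 1) (A : Language Bool) :
    ‖phiFin paramsS specS I.encode A fun _ => false‖ = (1 + I.value) / 2 := by
  obtain ⟨hq, hq0⟩ := isSelfDualBent_qM (even_WdS_of_le I h)
  have e : forrelation (fun w : Fin (WdS I) → Bool => cfun I 0 w) (fun w => cfun I 1 w) = I.value := by
    rw [forrelation_cfun I hk (WdS I) (sR_le_WdS I), value_eq, hk, WdS_eq_of_le I h, if_pos he,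
      Nat.add_zero]
  rw [phiFin_encode I hk, gS_vec, Complex.norm_real, Real.norm_eq_abs]
  have hg := kForrelationValue_gadget (fun w : Fin (WdS I) → Bool => cfun I 0 w) (fun w => cfun I 1 w)
    (qW I) hq hq0
  simp only at hg
  rw [show (qW I) = fun w => qW I w from rfl] at hg
  erw [hg, abs_gadget, e]

/-- **Exact acceptance off the promise**: `1 − (1 − ((1+Φ)/2)²)³`. [cite: AaronsonAmbainis2018, §3.2 Prop. 6] -/
theorem acceptProbOn_of_le (I : KForrelationInstance) (hk : I.k = 2) (he : Even I.n)
    (h : I.n ≤ sR I + 1) :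
    (family paramsS).acceptProbOn 0 I.encode = 1 - (1 - ((1 + I.value) / 2) ^ 2) ^ 3 := by
  rw [acceptProbOn_family paramsS specS I.encode 0, norm_phiFin_of_le I hk he h]

/-- `Φ(x₀x₁, x₀(1+x₁)) = 0`. [cite: AaronsonAmbainis2018, §1.1.1] -/
theorem forrelation_and_andNot :
    forrelation (fun x : Fin 2 → Bool => x 0 && x 1) (fun x => x 0 && !x 1) = 0 := by
  unfold forrelation
  simp only [← (piFinTwoEquiv fun _ : Fin 2 => Bool).symm.sum_comp, Fintype.sum_prod_type,
    Fintype.sum_bool, twist, Fin.prod_univ_two, signOf]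
  simp [piFinTwoEquiv]

/-- `x₀ ∧ ¬x₁` has algebraic degree `≤ 3`. [cite: Carlet2020, §2.2.1 Def. 6] -/
theorem isDegLeFun_andNot : IsDegLeFun 3 (fun x : Fin 2 → Bool => x 0 && !x 1) := by
  refine ⟨MvPolynomial.X 0 * (1 + MvPolynomial.X 1), ?_, fun x => ?_⟩
  · calc (MvPolynomial.X 0 * (1 + MvPolynomial.X 1) : MvPolynomial (Fin 2) (ZMod 2)).totalDegree
          ≤ (MvPolynomial.X 0 : MvPolynomial (Fin 2) (ZMod 2)).totalDegree +
            (1 + MvPolynomial.X 1 : MvPolynomial (Fin 2) (ZMod 2)).totalDegree :=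
            MvPolynomial.totalDegree_mul _ _
      _ ≤ 1 + 1 := by
            refine add_le_add (MvPolynomial.totalDegree_X (R := ZMod 2) _).le ?_
            refine (MvPolynomial.totalDegree_add _ _).trans (max_le ?_ ?_)
            · simp
            · exact (MvPolynomial.totalDegree_X (R := ZMod 2) _).le
      _ ≤ 3 := by norm_num
  · simp only [polyPhase, map_mul, map_add, map_one, MvPolynomial.eval_X]
    cases x 0 <;> cases x 1 <;> decide

/-- The witness, abstractly over the circuit `C'` computing `x₀ ∧ ¬x₁`. [cite: AaronsonAmbainis2018, §3.2 Prop. 6] -/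
theorem ungapped_of (C' : Circuit (Fin 2)) (hC' : ∀ x, C'.eval x = (x 0 && !x 1)) (hover : C'.IsOver B2)
    (hreads : (0 : ℕ) ∈ occList ⟨2, 2, ![andTwoCircuit, C']⟩) :
    (⟨2, 2, ![andTwoCircuit, C']⟩ : KForrelationInstance).IsOverB2 ∧
    (⟨2, 2, ![andTwoCircuit, C']⟩ : KForrelationInstance).k = 2 ∧
    Even (⟨2, 2, ![andTwoCircuit, C']⟩ : KForrelationInstance).n ∧
    (∀ i, IsDegLeFun 3 ((⟨2, 2, ![andTwoCircuit, C']⟩ : KForrelationInstance).C i).eval) ∧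
    (⟨2, 2, ![andTwoCircuit, C']⟩ : KForrelationInstance).n ≤ sR ⟨2, 2, ![andTwoCircuit, C']⟩ + 1 ∧
    (⟨2, 2, ![andTwoCircuit, C']⟩ : KForrelationInstance).value = 0 ∧
    (family paramsS).acceptProbOn 0 (KForrelationInstance.encode ⟨2, 2, ![andTwoCircuit, C']⟩) = 37 / 64 := by
  set I : KForrelationInstance := ⟨2, 2, ![andTwoCircuit, C']⟩ with hI
  have hC'f : C'.eval = fun x => x 0 && !x 1 := funext hC'
  have hB2 : I.IsOverB2 := by
    intro i
    fin_cases i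
    · exact andTwoCircuit_isOver
    · exact hover
  have hdeg : ∀ i, IsDegLeFun 3 (I.C i).eval := by
    intro i
    fin_cases i
    · exact isDegLeFun_andTwoCircuit_eval
    · show IsDegLeFun 3 C'.eval
      rw [hC'f]; exact isDegLeFun_andNot
  have hle : I.n ≤ sR I + 1 := by
    have h1 : (Rl I).map bitsToNat ≠ [] := List.ne_nil_of_mem ((mem_Rl_values_iff I 0).2 hreads)
    have h2 : 1 ≤ sR I := by
      rw [Nat.one_le_iff_ne_zero]
      intro h
      apply h1
      rw [List.map_eq_nil_iff, ← List.length_eq_zero_iff]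
      exact h
    show 2 ≤ sR I + 1
    omega
  have hval : I.value = 0 := by
    rw [hI, KForrelationInstance.value_mk_two]
    simp only [Matrix.cons_val_zero, Matrix.cons_val_one]
    rw [hC'f, show andTwoCircuit.eval = fun x : Fin 2 → Bool => x 0 && x 1 from funext andTwoCircuit_eval]
    exact forrelation_and_andNot
  refine ⟨hB2, rfl, (show Even 2 from even_two), hdeg, hle, hval, ?_⟩
  rw [acceptProbOn_of_le I rfl (show Even 2 from even_two) hle, hval]
  norm_num

/-- **A well-formed cubic code on which the landed signed family is ungapped** (acceptance `37/64`).
[cite: AaronsonAmbainis2018, §3.2 Prop. 6] -/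
theorem exists_wf_cubic_code_ungapped :
    ∃ I : KForrelationInstance, I.IsOverB2 ∧ I.k = 2 ∧ Even I.n ∧ (∀ i, IsDegLeFun 3 (I.C i).eval) ∧
      I.n ≤ sR I + 1 ∧ I.value = 0 ∧ (family paramsS).acceptProbOn 0 I.encode = 37 / 64 :=
  ⟨_, ungapped_of
    { gates := [⟨2, fun v => v 0 && !v 1, fun a => .inl a⟩]
      output := .inr 0
      wf := fun j h a m hm => by
        simp only [List.length_singleton, Nat.lt_one_iff] at h
        subst h
        simp at hm
      wf_output := fun m h => by cases h; simp }
    (fun _ => rfl)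
    (by intro g hg; simp only [List.mem_singleton] at hg; subst hg; exact le_refl 2)
    (by decide)⟩

/-- **The landed family decides NO language in the BQP sense.** [cite: AaronsonAmbainis2018, §3.2 Prop. 6] -/
theorem landedFamily_not_bqp_decider :
    ¬ ∃ L : Language Bool, ∀ x, (x ∈ L → (2 : ℝ) / 3 ≤ (family paramsS).acceptProbOn 0 x) ∧
      (x ∉ L → (family paramsS).acceptProbOn 0 x ≤ 1 / 3) := by
  rintro ⟨L, hL⟩
  obtain ⟨I, -, -, -, -, -, -, hacc⟩ := exists_wf_cubic_code_ungapped
  obtain ⟨hy, hn⟩ := hL I.encode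
  by_cases hx : I.encode ∈ L
  · have := hy hx; rw [hacc] at this; norm_num at this
  · have := hn hx; rw [hacc] at this; norm_num at this

/-- **Refuted strengthening (K = 1 shortcut of stub V)**, independent of r2. [cite: AaronsonAmbainis2018, §3.2 Prop. 6] -/
theorem not_noSide_le_third :
    ¬ ∀ I : KForrelationInstance, I.IsOverB2 → I.k = 2 → Even I.n → (∀ i, IsDegLeFun 3 (I.C i).eval) →
      I.n ≤ sR I + 1 → I.value ≠ 1 → (family paramsS).acceptProbOn 0 I.encode ≤ 1 / 3 := by
  intro h
  obtain ⟨I, h1, h2, h3, h4, h5, h6, hacc⟩ := exists_wf_cubic_code_ungapped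
  have := h I h1 h2 h3 h4 h5 (by rw [h6]; norm_num)
  rw [hacc] at this
  norm_num at this

/-! ## §2b–c Degree projection load-bearing; top-gap tightness (statements; proofs in the Negative files)

```
-- Negative/DegreeBlindUngapped.lean (p103712)
theorem exists_allRead_code_value (t : ℕ) (ht : 1 ≤ t) :
    ∃ I : KForrelationInstance, I.IsOverB2 ∧ I.k = 2 ∧ I.n = t + t ∧ Even I.n ∧ I.n ≤ sR I ∧
      I.value = 1 - 2 / (4 : ℝ) ^ t ∧
      I.encode ∉ (signedExactCubicForrelationProblem 2).yes ∧
      I.encode ∉ (signedExactCubicForrelationProblem 2).no ∧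
      1 - 2 / (4 : ℝ) ^ t ≤ (family paramsS).acceptProbOn 0 I.encode
theorem degreeBlind_andPower_ungapped (K : ℕ) :
    ∃ I : KForrelationInstance, I.IsOverB2 ∧ I.k = 2 ∧ Even I.n ∧ I.n ≤ sR I ∧
      (1 : ℝ) / 2 ≤ I.value ∧ I.value < 1 ∧
      I.encode ∉ (signedExactCubicForrelationProblem 2).yes ∧
      I.encode ∉ (signedExactCubicForrelationProblem 2).no ∧
      (1 : ℝ) / 3 < (family paramsS).acceptProbOn 0 I.encode ^ K
-- Negative/TopGapTightness.lean (proposed)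
theorem stubV_p0_ge_of_pair (p₀ : ℝ)
    (h : ∀ I : KForrelationInstance, I.IsOverB2 → I.k = 2 → Even I.n → (∀ i, IsDegLeFun 3 (I.C i).eval) →
      I.n ≤ sR I + 1 → I.value ≠ 1 → (family paramsS).acceptProbOn 0 I.encode ≤ p₀)
    {m : ℕ} (f g : (Fin (m + m) → Bool) → Bool) (hf : IsDegLeFun 3 f) (hg : IsDegLeFun 3 g)
    (hdepg : ∀ i, ∃ x x' : Fin (m + m) → Bool, (∀ l, l ≠ i → x l = x' l) ∧ g x ≠ g x')
    (hne : forrelation f g ≠ 1) :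
    1 - (1 - ((1 + forrelation f g) / 2) ^ 2) ^ 3 ≤ p₀
theorem stubV_p0_ge_kasamiTokura (p₀ : ℝ) (h : …same…) : 1 - ((15 : ℝ) / 64) ^ 3 ≤ p₀
theorem andPower_copies_ge_52 (p₀ : ℝ) (K : ℕ) (h : …same…) (hK : p₀ ^ K ≤ 1 / 3) : 52 ≤ K
```
-/

/-! ## §3 Line `Sketch` (reduce-then-lift): stub V proved; stubs A, C audited

Definitions `WF`, `gappedSlice`, `LandedFamilyValueSet`, `AndPowerAmplification` are copied VERBATIM from
the picked skeleton (`Cruxes/SignedExactSliceIsLift/Ideas/reduce-then-lift.md` appendix = the lead's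
`Sketch.lean`), so the theorems below transfer by copy-paste. -/

/-- (skeleton) well-formed cubic instances. -/
def WF : Set KForrelationInstance :=
  {I | I.IsOverB2 ∧ I.k = 2 ∧ Even I.n ∧ (∀ i, IsDegLeFun 3 (I.C i).eval) ∧ I.n ≤ ForrMem.sR I + 1}

/-- (skeleton) the θ-gapped canonical slice. -/
def gappedSlice : PromiseProblem :=
  ⟨slice.yes, KForrelationInstance.encode '' {I | I ∈ WF ∧ I.value ≠ 1}⟩

/-- (skeleton) STUB V. -/
def LandedFamilyValueSet : Prop :=
  NearExactIsExact → ∃ p₀ : ℝ, p₀ < 1 ∧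
    (∀ x ∈ gappedSlice.yes, (PhaseQuery.family SgnForrMem.paramsS).acceptProbOn 0 x = 1) ∧
    (∀ x ∈ gappedSlice.no, (PhaseQuery.family SgnForrMem.paramsS).acceptProbOn 0 x ≤ p₀)

/-- (skeleton) STUB A. -/
def AndPowerAmplification : Prop :=
  ∀ (F : QCircuitFamily cliffordT), F.IsOracleFree → F.IsUniform → ∀ K : ℕ, 0 < K →
    ∃ F' : QCircuitFamily cliffordT, F'.IsOracleFree ∧ F'.IsUniform ∧
      ∀ x : List Bool, F'.acceptProbOn 0 x = F.acceptProbOn 0 x ^ K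

/-- **Stub V, yes side (no r2 needed)**: on every code of the exact slice the landed family accepts
with probability EXACTLY `1`. [cite: AaronsonAmbainis2018, §3.2 Prop. 6] -/
theorem stubV_yes (x : List Bool) (hx : x ∈ slice.yes) : (family paramsS).acceptProbOn 0 x = 1 := by
  obtain ⟨I, ⟨-, hv, hk, he, -⟩, rfl⟩ := hx
  have hle : I.n ≤ sR I + 1 := n_le_of_promise I hk (by rw [hv]; norm_num)
  rw [acceptProbOn_of_le I hk he hle, hv]
  norm_num

/-- The value of a well-formed cubic instance with `Φ ≠ 1` is `≤ θ` under isolation at `θ`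
(r2 read contrapositively through `value_eq_forrelation`). [cite: DuttaMaitraMukherjee2024, §3] -/
theorem value_le_of_isolation {θ : ℝ}
    (hθ : ∀ n : ℕ, Even n → ∀ f g : (Fin n → Bool) → Bool, IsDegLeFun 3 f → IsDegLeFun 3 g →
      θ < forrelation f g → forrelation f g = 1)
    (I : KForrelationInstance) (hk : I.k = 2) (he : Even I.n) (hdeg : ∀ i, IsDegLeFun 3 (I.C i).eval)
    (hv : I.value ≠ 1) : I.value ≤ θ := by
  by_contra hlt
  push Not at hlt
  rw [KForrelationInstance.value_eq_forrelation hk] at hv hlt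
  exact hv (hθ I.n he _ _ (hdeg _) (hdeg _) hlt)

/-- **Stub V, no side**: under `NearExactIsExact` the landed family accepts every well-formed cubic code
with `Φ ≠ 1` with probability `≤ p₀ := 1 − (1 − ((1+θ₊)/2)²)³ < 1`, `θ₊ = max θ 0`.
[cite: AaronsonAmbainis2018, §3.2 Prop. 6] -/
theorem stubV_no (hNE : NearExactIsExact) : ∃ p₀ : ℝ, p₀ < 1 ∧
    ∀ x ∈ gappedSlice.no, (family paramsS).acceptProbOn 0 x ≤ p₀ := by
  obtain ⟨θ, hθ1, hθ⟩ := hNE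
  set t : ℝ := max θ 0 with ht
  have ht0 : 0 ≤ t := le_max_right _ _
  have ht1 : t < 1 := max_lt hθ1 one_pos
  refine ⟨1 - (1 - ((1 + t) / 2) ^ 2) ^ 3, ?_, ?_⟩
  · have hb : 0 < 1 - ((1 + t) / 2) ^ 2 := by nlinarith
    have : 0 < (1 - ((1 + t) / 2) ^ 2) ^ 3 := pow_pos hb 3
    linarith
  · rintro x ⟨I, ⟨⟨hB, hk, he, hdeg, hle⟩, hv⟩, rfl⟩
    rw [acceptProbOn_of_le I hk he hle]
    have hvθ : I.value ≤ t := (value_le_of_isolation hθ I hk he hdeg hv).trans (le_max_left _ _)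
    have hv1 : -1 ≤ I.value := (abs_le.1 (SgnForrMem.abs_value_le_one I)).1
    have ha0 : 0 ≤ (1 + I.value) / 2 := by linarith
    have hab : (1 + I.value) / 2 ≤ (1 + t) / 2 := by linarith
    have hb1 : (1 + t) / 2 ≤ 1 := by linarith
    have hsq : ((1 + I.value) / 2) ^ 2 ≤ ((1 + t) / 2) ^ 2 := pow_le_pow_left₀ ha0 hab 2
    have hb2 : ((1 + t) / 2) ^ 2 ≤ 1 := pow_le_one₀ (by linarith) hb1
    have hcube : (1 - ((1 + t) / 2) ^ 2) ^ 3 ≤ (1 - ((1 + I.value) / 2) ^ 2) ^ 3 :=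
      pow_le_pow_left₀ (by linarith) (by linarith) 3
    linarith

/-- **STUB V HOLDS** (as stated in the skeleton; r2 is used exactly once, on the no side). -/
theorem stubV_holds : LandedFamilyValueSet := by
  intro hNE
  obtain ⟨p₀, hp₀, hno⟩ := stubV_no hNE
  exact ⟨p₀, hp₀, fun x hx => stubV_yes x hx, hno⟩

/-- Stub A at `K = 1` (shape check against the tree objects; the content is `K ≥ 2`). -/
theorem andPower_at_one (F : QCircuitFamily cliffordT) (hF : F.IsOracleFree) (hU : F.IsUniform) :
    ∃ F' : QCircuitFamily cliffordT, F'.IsOracleFree ∧ F'.IsUniform ∧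
      ∀ x : List Bool, F'.acceptProbOn 0 x = F.acceptProbOn 0 x ^ 1 :=
  ⟨F, hF, hU, fun _ => (pow_one _).symm⟩

/-- By §2 the landed family itself is no witness: with stub A one needs `K ≥ 3` already for the single
ungapped code (`(37/64)² > 1/3 ≥ (37/64)³`), and `p₀(θ)^K ≤ 1/3` in general. -/
theorem thirtyseven_64_pow : ((37 : ℝ) / 64) ^ 2 > 1 / 3 ∧ ((37 : ℝ) / 64) ^ 3 ≤ 1 / 3 := by
  constructor <;> norm_num

/-! ## §3b Targets: the lead's stubs on small models (checked by `decide` against the Defs vocabulary) -/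

section Targets

open Summit.QuantumAdvantage.QuantumAdvantage.Theorems.SignedExactSliceIsLift
  (truncOf evalMonos anfPC cubicMonomials guardOK canonOf)

/-- stub_moebius conj. 2, n = 3, `f = x₀x₁x₂`. -/
theorem moebius_check_and3 : ∀ x : Fin 3 → Bool,
    truncOf 3 (fun v => (fun y : Fin 3 → Bool => y 0 && y 1 && y 2) (ForrCode.toInput 3 v)) x = (x 0 && x 1 && x 2) := by
  decide

/-- stub_moebius conj. 2, n = 3, asymmetric `f = ¬(x₀ ∧ x₂)`. -/
theorem moebius_check_nand02 : ∀ x : Fin 3 → Bool,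
    truncOf 3 (fun v => (fun y : Fin 3 → Bool => !(y 0 && y 2)) (ForrCode.toInput 3 v)) x = !(x 0 && x 2) := by
  decide

/-- stub_moebius conj. 2, n = 4, `f = x₀x₁x₃ ⊕ x₂`. -/
theorem moebius_check_cubic4 : ∀ x : Fin 4 → Bool,
    truncOf 4 (fun v => (fun y : Fin 4 → Bool => xor (y 0 && y 1 && y 3) (y 2)) (ForrCode.toInput 4 v)) x
      = xor (x 0 && x 1 && x 3) (x 2) := by
  decide

/-- stub_moebius conj. 2, n = 4, `f = ¬(x₀x₁x₂ ⊕ x₁x₂x₃ ⊕ x₀)`. -/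
theorem moebius_check_cubic4' : ∀ x : Fin 4 → Bool,
    truncOf 4 (fun v => (fun y : Fin 4 → Bool => !(xor (xor (y 0 && y 1 && y 2) (y 1 && y 2 && y 3)) (y 0)))
      (ForrCode.toInput 4 v)) x = !(xor (xor (x 0 && x 1 && x 2) (x 1 && x 2 && x 3)) (x 0)) := by
  decide

/-- stub_anfCircuit netlist semantics, n = 3, mons = `[∅, {0}, {1,2}, {0,1,2}]`. -/
theorem anfPC_check_3 : ∀ x : Fin 3 → Bool,
    ForrCode.evalP (anfPC 3 [[], [0], [1,2], [0,1,2]]) (List.ofFn x) = evalMonos 3 [[], [0], [1,2], [0,1,2]] x := by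
  decide

/-- … and `evalMonos` is the intended XOR of monomials there. -/
theorem evalMonos_check_3 : ∀ x : Fin 3 → Bool,
    evalMonos 3 [[], [0], [1,2], [0,1,2]] x = !(xor (xor (x 0) (x 1 && x 2)) (x 0 && x 1 && x 2)) := by
  decide

/-- stub_anfCircuit netlist semantics, n = 2: `[{0,1}] ↦ x₀ ∧ x₁`, `[] ↦ false`. -/
theorem anfPC_check_2 : (∀ x : Fin 2 → Bool, ForrCode.evalP (anfPC 2 [[0,1]]) (List.ofFn x) = (x 0 && x 1)) ∧
    (∀ x : Fin 2 → Bool, ForrCode.evalP (anfPC 2 []) (List.ofFn x) = false) := by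
  constructor <;> decide

/-- **The n = 0 fallback computes (false, false)**: `evalP (anfPC 0 []) [] = false` (so the fallback instance
has `Φ = (+1)(+1) = +1`: a YES code), while `anfPC 0 [[]]` computes `true`. -/
theorem fallback_value_bits : ForrCode.evalP (anfPC 0 []) [] = false ∧ ForrCode.evalP (anfPC 0 [[]]) [] = true := by
  constructor <;> decide

/-- The guard rejects odd `n`, `k ≠ 2`, `n > L + 1`, and accepts `(2, 2, ·)` at `L = 10`; the fallback branch. -/
theorem guard_check : guardOK (3, 2, []) 10 = false ∧ guardOK (2, 3, []) 10 = false ∧ guardOK (4, 2, []) 2 = false ∧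
    guardOK (2, 2, []) 10 = true ∧ canonOf (3, 2, []) 10 = (0, 2, [anfPC 0 [], anfPC 0 []]) := by
  refine ⟨by decide, by decide, by decide, by decide, rfl⟩

end Targets

/-! ## §4 Near-misses (NOT expected to close; recorded to mark the obstruction) -/

/-- NEAR-MISS (`sorry`): the r2-free version refuted. By `lower_bound_of_not_without` this is a circuit
lower bound (`slice ∉ PromiseP`: no total poly-time sign algorithm for exact cubic bent/dual pairs),
i.e. at least the hardness direction of crux r3 in deterministic form. Out of reach and not this
seat's thesis. -/
theorem not_cruxWithoutIsolation : ¬ CruxWithoutIsolation := by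
  sorry

/-- NEAR-MISS (`sorry`): the crux refuted. By `not_crux_iff` this needs BOTH a proof of the open rank-2
crux `NearExactIsExact` (θ* ≥ 15/16 today, no proof at any θ < 1) AND the lower bound above. No
formalisation defect offers a shortcut (§0 verdict). -/
theorem crux_refuted : ¬ SignedExactSliceIsLift := by
  sorry

end Summit.QuantumAdvantage.QuantumAdvantage.Cruxes.SignedExactSliceIsLift.Disproof

end
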